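import Summits.PneNP.PneNP.Theorems.ReslinSizeFromWidthQuadratic
import Summits.PneNP.PneNP.Theorems.ReslinSizeFromWidthTreeLikeCore

/-!
# PneNP / ReslinSizeFromWidth — the TREE-LIKE size–width law for Res(⊕), part 2: the law
(supports crux `ResLinSizeFromWidth`, stmt-PneNP-18932)

Route `PneNP/ReslinSizeFromWidth`.  The crux X1 = `ResLinSizeFromWidth` asks, for dag-like Res(⊕)
(Itsykson–Sokolov's system with SEMANTIC weakening), that rank-width `≥ N/m` force more than `N^C`
lines for every `C`.  Its TREE-LIKE truncation is a theorem, proved here in the tree's vocabulary: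

* `ResLinSW.exists_isRef_of_treeLike_aux` (semantic core): along a TREE-LIKE Res(⊕) derivation `π`
  (every line used as a premise at most once — the verbatim analogue for `ResLinLine` of
  `Literature.Computability.MetaComplexity.IsTreeLike`), for every line `k` and every nonempty
  ambient flat `A` inside the falsifying flat of line `k`, there is a semantic refutation inside `A`
  (`ResLinSW.IsRef`, the framework of the quadratic law) of width `≤ t + ⌊log₂ |ancestors k|⌋`.
  Induction on the size of the sub-derivation: at a resolution step on `f` the two premise
  sub-derivations are disjoint (tree-likeness), the smaller one has at most half the lines, and the
  restriction lemma for width (`ResLinSW.glue`) recombines the two halves `A ∩ {f = 0}`,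
  `A ∩ {f = 1}` paying `+1` only on the smaller side — Ben-Sasson–Wigderson's Theorem 3.3 one
  proof system up.
* `ResLinSW.exists_refutation_of_treeLike`: a tree-like Res(⊕) refutation `π` of a width-`≤ t` CNF
  yields a Res(⊕) refutation of rank-width `≤ t + 1 + ⌊log₂ |π|⌋`.
* `ResLinSW.pow_le_length_of_treeLike` (**tree-like size–width law**): if every Res(⊕) refutation
  of `φ` (clause width `≤ t`) has rank-width `≥ k`, every TREE-LIKE Res(⊕) refutation of `φ` has at
  least `2^(k - t - 1)` lines.
* Corollaries: `resLinSizeFromWidth_treeLike` — X1 HOLDS FOR TREE-LIKE REFUTATIONS (every exponent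
  `C`); `randomThreeCnf_treeLike_resLinSize_exp` — for `c ≥ 6` there is `δ > 0` with
  `Pr_{F₃(n,cn)}[unsat ∧ every tree-like Res(⊕) refutation has ≥ 2^(δ n) lines] → 1`.

In print (this is a REPRODUCTION, kernel-checked): the tree-like size–width relation for tree-like
R(lin) with semantic weakening over any field, for principal width, and over finite fields for
width (Part–Tzameret, Comput. Complexity 2021 = arXiv:1806.09383, Thm "Size-width relation" p. 7;
Garlík–Kołodziejczyk 2018 for tree-like PK_{O(1)}^{id}(⊕); Khaniki ECCC TR20-034 Thm 3.5(2) for the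
syntactic-weakening system); rank ≤ width, so the RANK form here follows from the width form.
Tree-like Res(⊕) lower bounds for random k-CNF are likewise in print (Part–Tzameret Cor. p. 7;
Itsykson–Sokolov 2020 via Prover–Delayer games). New in tree only: the statement for the tree's
`IsResLinRefutation` (semantic weakening) with `resLinWidth` (rank), machine-checked.
[BenSassonWigderson2001, Thm 3.3; ItsyksonSokolov2020, §3; PartTzameret2018, Thm size–width]
-/

namespace Summit.PneNP.PneNP.Theorems

-- `Summit.PneNP.PneNP` repeats a path component by design (summit = sub-problem); silence the linter.
set_option linter.dupNamespace false

namespace ResLinSW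

section TreeLike

open Module Submodule Finset
open Literature.Computability.Complexity Literature.Computability.MetaComplexity
open Literature.Computability.MetaComplexity.AffSys
open Summit.PneNP.PneNP.Theorems.ResLinRank

/-! ### Arithmetic of the corollaries -/

section Arith

open Filter Topology

/-- Polynomial versus exponential with a linear slowdown: eventually `N^C < 2^(N/m - t - 1)`. -/
theorem exists_pow_lt_two_pow_div_sub (C m t : ℕ) (hm : 0 < m) :
    ∃ N₀ : ℕ, ∀ N : ℕ, N₀ ≤ N → N ^ C < 2 ^ (N / m - t - 1) := by
  -- M^C · K < 2^M eventually, with K = m^C · 2^C · 2^(t+1)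
  set K : ℕ := m ^ C * 2 ^ C * 2 ^ (t + 1) with hK
  have hKpos : 0 < K := by positivity
  have hlim := tendsto_pow_const_div_const_pow_of_one_lt C (one_lt_two : (1 : ℝ) < 2)
  have hev : ∀ᶠ M : ℕ in atTop, (M : ℝ) ^ C / 2 ^ M < 1 / K := by
    refine (hlim.eventually (gt_mem_nhds ?_))
    positivity
  obtain ⟨M₁, hM₁⟩ := eventually_atTop.1 hev
  set M₀ : ℕ := max M₁ (t + 2) with hM₀
  refine ⟨m * M₀, fun N hN => ?_⟩
  set M := N / m with hMdef
  have hMM₀ : M₀ ≤ M := by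
    rw [hMdef, Nat.le_div_iff_mul_le hm]; rw [mul_comm]; exact hN
  have hM1 : M₁ ≤ M := le_trans (le_max_left _ _) hMM₀
  have hMt : t + 2 ≤ M := le_trans (le_max_right _ _) hMM₀
  have hNlt : N < m * (M + 1) := by
    have := Nat.lt_div_mul_add (a := N) hm
    rw [← hMdef] at this
    linarith [mul_comm M m]
  -- real inequality M^C · K < 2^M
  have hkey : ((M : ℝ) ^ C) * K < (2 : ℝ) ^ M := by
    have h := hM₁ M hM1
    rw [div_lt_div_iff₀ (by positivity) (by exact_mod_cast hKpos), one_mul] at h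
    linarith
  have hkeyN : M ^ C * K < 2 ^ M := by exact_mod_cast hkey
  -- N^C < (m (M+1))^C ≤ m^C (2M)^C = m^C 2^C M^C
  have h1 : N ^ C ≤ (m * (M + 1)) ^ C := Nat.pow_le_pow_left hNlt.le C
  have h2 : (m * (M + 1)) ^ C ≤ m ^ C * 2 ^ C * M ^ C :=
    calc (m * (M + 1)) ^ C ≤ (m * (2 * M)) ^ C := Nat.pow_le_pow_left (by nlinarith) C
      _ = m ^ C * 2 ^ C * M ^ C := by rw [mul_pow, mul_pow, mul_assoc]
  -- 2^M = 2^(M - t - 1) * 2^(t+1)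
  have h3 : 2 ^ M = 2 ^ (M - t - 1) * 2 ^ (t + 1) := by
    rw [← pow_add]; congr 1; omega
  have h4 : m ^ C * 2 ^ C * M ^ C * 2 ^ (t + 1) < 2 ^ (M - t - 1) * 2 ^ (t + 1) := by
    rw [← h3]
    calc m ^ C * 2 ^ C * M ^ C * 2 ^ (t + 1) = M ^ C * K := by rw [hK]; ring
      _ < 2 ^ M := hkeyN
  have h5 : m ^ C * 2 ^ C * M ^ C < 2 ^ (M - t - 1) :=
    Nat.lt_of_mul_lt_mul_right h4
  calc N ^ C ≤ (m * (M + 1)) ^ C := h1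
    _ ≤ m ^ C * 2 ^ C * M ^ C := h2
    _ < 2 ^ (M - t - 1) := h5

/-- Eventually `2^(⌊δ₀ n⌋₊ + 1 - 3 - 1) ≥ 2^(δ₀/2 · n)` as reals, for `δ₀ > 0`. -/
theorem eventually_pow_floor_ge (δ₀ : ℝ) (hδ₀ : 0 < δ₀) :
    ∀ᶠ n : ℕ in atTop, (2 : ℝ) ^ (δ₀ / 2 * n) ≤ ((2 ^ (⌊δ₀ * n⌋₊ + 1 - 3 - 1) : ℕ) : ℝ) := by
  refine eventually_atTop.2 ⟨⌈8 / δ₀⌉₊, fun n hn => ?_⟩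
  have hn8 : 8 ≤ δ₀ * n := by
    have h1 : (⌈8 / δ₀⌉₊ : ℝ) ≤ n := by exact_mod_cast hn
    have h2 : 8 / δ₀ ≤ n := (Nat.le_ceil _).trans h1
    rw [div_le_iff₀ hδ₀] at h2
    linarith
  have hfloor : δ₀ * n - 1 < (⌊δ₀ * n⌋₊ : ℝ) := Nat.sub_one_lt_floor _
  have hexp : δ₀ / 2 * n ≤ ((⌊δ₀ * n⌋₊ + 1 - 3 - 1 : ℕ) : ℝ) := by
    have h4 : 4 ≤ ⌊δ₀ * n⌋₊ := Nat.le_floor (by push_cast; linarith)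
    rw [Nat.cast_sub (by omega), Nat.cast_sub (by omega)]
    push_cast
    linarith
  push_cast
  calc (2 : ℝ) ^ (δ₀ / 2 * n) ≤ (2 : ℝ) ^ (((⌊δ₀ * n⌋₊ + 1 - 3 - 1 : ℕ) : ℝ)) :=
        Real.rpow_le_rpow_of_exponent_le one_le_two hexp
    _ = (2 : ℝ) ^ (⌊δ₀ * n⌋₊ + 1 - 3 - 1) := Real.rpow_natCast 2 _

end Arith

/-! ### The law -/

/-- **A tree-like Res(⊕) refutation yields a narrow Res(⊕) refutation**: if `π` is a tree-like
Res(⊕) refutation of the width-`≤ t` CNF `φ`, then `φ` has a Res(⊕) refutation of rank-width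
`≤ t + 1 + ⌊log₂ |π|⌋` (semantic core on the window of `φ` and `π`, then back to syntax by
`exists_refutation_of_isRef`, whence the `+1`). -/
theorem exists_refutation_of_treeLike {φ : CNF ℕ} {t : ℕ} (hφ : φ.IsWidthLE t)
    {π : List ResLinLine} (hπ : IsResLinRefutation φ π)
    (htree : ∀ i : ℕ, (π.map fun l => l.premises.count i).sum ≤ 1) :
    ∃ π' : List ResLinLine, IsResLinRefutation φ π' ∧
      resLinWidth π' ≤ t + 1 + Nat.log 2 π.length := by
  classical
  -- the window
  let M : Finset ℕ := piVars π ∪ cnfVars φ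
  have hNπ : ∀ l ∈ π, ∀ lit ∈ l.clause, lit.1 ⊆ M :=
    fun l hl lit hlit => (subset_piVars hl hlit).trans Finset.subset_union_left
  have hNφ : cnfVars φ ⊆ M := Finset.subset_union_right
  -- the root: an empty clause, whose falsifying flat is `univ`
  obtain ⟨hder, l, hl, hl0⟩ := hπ
  obtain ⟨r, hr, rfl⟩ := List.getElem_of_mem hl
  have hAk : (Set.univ : Set (↥M → ZMod 2)) ⊆ falsN M (π[r]'hr).clause := by
    rw [hl0, falsN_empty]
  obtain ⟨R, hR, hw⟩ := exists_isRef_of_treeLike_aux M hder htree hNπ π.length r hr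
    ((card_lAncestors_le r).trans hr) Set.univ isFlat_univ ⟨0, Set.mem_univ _⟩ hAk
    (goodAxioms_axiomFlats M hφ)
  obtain ⟨π', hπ', hw'⟩ := exists_refutation_of_isRef M hφ hNφ hR
  refine ⟨π', hπ', hw'.trans ?_⟩
  rw [max_le_iff]
  exact ⟨by omega, by omega⟩

/-- **Tree-like size–width law for Res(⊕).** For a CNF `φ` of clause width `≤ t`: if every Res(⊕)
refutation of `φ` (Itsykson–Sokolov's system with semantic weakening) has a line of rank `≥ k`,
then every TREE-LIKE Res(⊕) refutation `π` of `φ` (each line used as a premise at most once) has at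
least `2^(k - t - 1)` lines. -/
theorem pow_le_length_of_treeLike {φ : CNF ℕ} {t k : ℕ} (hφ : φ.IsWidthLE t)
    (hk : ∀ π, IsResLinRefutation φ π → k ≤ resLinWidth π) {π : List ResLinLine}
    (hπ : IsResLinRefutation φ π) (htree : ∀ i : ℕ, (π.map fun l => l.premises.count i).sum ≤ 1) :
    2 ^ (k - t - 1) ≤ π.length := by
  obtain ⟨π', hπ', hw'⟩ := exists_refutation_of_treeLike hφ hπ htree
  have hkle : k ≤ t + 1 + Nat.log 2 π.length := (hk π' hπ').trans hw'
  have hpos : π.length ≠ 0 := by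
    obtain ⟨-, l, hl, -⟩ := hπ
    exact List.ne_nil_iff_length_pos.1 (List.ne_nil_of_mem hl) |>.ne'
  calc 2 ^ (k - t - 1) ≤ 2 ^ Nat.log 2 π.length := Nat.pow_le_pow_right (by norm_num) (by omega)
    _ ≤ π.length := Nat.pow_log_le_self 2 hpos

end TreeLike

end ResLinSW

section Corollaries

open Filter Literature.Computability.Complexity Literature.Computability.MetaComplexity
open scoped Topology

/-- **The crux `ResLinSizeFromWidth` HOLDS FOR TREE-LIKE REFUTATIONS** (every exponent `C`): for all
`t`, `m ≥ 1`, `C` there is `N₀` such that for every `N ≥ N₀` and every CNF `φ` of clause width `≤ t`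
(on `≤ N` variables): if every Res(⊕) refutation `π` of `φ` has `N ≤ m · resLinWidth π`, then every
TREE-LIKE Res(⊕) refutation of `φ` has more than `N^C` lines (tree-like law with `k = ⌊N/m⌋` and
`N^C < 2^(⌊N/m⌋ - t - 1)` eventually). The dag-like statement (X1 itself) stays open. -/
theorem resLinSizeFromWidth_treeLike :
    ∀ t m C : ℕ, 0 < m → ∃ N₀ : ℕ, ∀ N : ℕ, N₀ ≤ N → ∀ φ : CNF ℕ, φ.IsWidthLE t → φ.numVars ≤ N →
      (∀ π : List ResLinLine, IsResLinRefutation φ π → N ≤ m * resLinWidth π) →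
      ∀ π : List ResLinLine, IsResLinRefutation φ π →
        (∀ i : ℕ, (π.map fun l => l.premises.count i).sum ≤ 1) → N ^ C < π.length := by
  intro t m C hm
  obtain ⟨N₀, hN₀⟩ := ResLinSW.exists_pow_lt_two_pow_div_sub C m t hm
  refine ⟨N₀, fun N hN φ hφ _ hwidth π hπ htree => ?_⟩
  have hkw : ∀ π', IsResLinRefutation φ π' → N / m ≤ resLinWidth π' := by
    intro π' hπ'
    have h := hwidth π' hπ'
    calc N / m ≤ (m * resLinWidth π') / m := Nat.div_le_div_right h
      _ = resLinWidth π' := by rw [Nat.mul_div_cancel_left _ hm]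
  exact (hN₀ N hN).trans_le (ResLinSW.pow_le_length_of_treeLike hφ hkw hπ htree)

/-- **Random 3-CNFs need exponential-size TREE-LIKE Res(⊕) refutations whp**: for `c ≥ 6` there is
`δ > 0` with `Pr_{φ ∼ F₃(n, cn)}[φ unsat ∧ every tree-like Res(⊕) refutation π of φ has
2^(δ n) ≤ |π|] → 1` (rank-width `> δ₀ n` whp by `randomThreeCnf_resLinRank_linear`, width `3`, the
tree-like law; `δ = δ₀/2`). In print for tree-like Res(⊕)/R(lin) via Prover–Delayer games and
principal width (Itsykson–Sokolov; Part–Tzameret Cor. "Random k-CNF"); here from the RANK bound of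
rung 1, kernel-checked. -/
theorem randomThreeCnf_treeLike_resLinSize_exp (c : ℕ) (hc : 6 ≤ c) :
    ∃ δ : ℝ, 0 < δ ∧ Tendsto (fun n : ℕ => (randomKCNF 3 n (c * n)).toOuterMeasure
      {φ | ¬ CNF.Satisfiable φ ∧ ∀ π : List ResLinLine, IsResLinRefutation φ π →
        (∀ i : ℕ, (π.map fun l => l.premises.count i).sum ≤ 1) →
        (2 : ℝ) ^ (δ * n) ≤ (π.length : ℝ)}) atTop (𝓝 1) := by
  obtain ⟨δ₀, hδ₀, hlim⟩ := randomThreeCnf_resLinRank_linear c hc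
  refine ⟨δ₀ / 2, by positivity, ?_⟩
  -- width 3 inside the support
  have hwidth : ∀ {n m : ℕ} {φ : CNF ℕ}, φ ∈ (randomKCNF 3 n m).support → φ.IsWidthLE 3 := by
    intro n m φ hφ cl hcl
    exact (length_of_mem_kClauses (forall_mem_of_mem_support_randomKCNF hφ cl hcl)).le
  -- eventually the rank event (within the support) lies inside the tree-like size event
  have hev : ∀ᶠ n : ℕ in atTop,
      (randomKCNF 3 n (c * n)).toOuterMeasure
          {φ | ¬ CNF.Satisfiable φ ∧ ∀ π : List ResLinLine, IsResLinRefutation φ π →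
            δ₀ * n < (resLinWidth π : ℝ)} ≤
        (randomKCNF 3 n (c * n)).toOuterMeasure
          {φ | ¬ CNF.Satisfiable φ ∧ ∀ π : List ResLinLine, IsResLinRefutation φ π →
            (∀ i : ℕ, (π.map fun l => l.premises.count i).sum ≤ 1) →
            (2 : ℝ) ^ (δ₀ / 2 * n) ≤ (π.length : ℝ)} := by
    filter_upwards [ResLinSW.eventually_pow_floor_ge δ₀ hδ₀] with n hn
    refine PMF.toOuterMeasure_mono _ ?_
    rintro φ ⟨⟨hns, hrank⟩, hsupp⟩
    refine ⟨hns, fun π hπ htree => ?_⟩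
    have hφ3 : φ.IsWidthLE 3 := hwidth hsupp
    -- k = ⌊δ₀ n⌋ + 1 bounds every rank-width from below
    have hkw : ∀ π', IsResLinRefutation φ π' → ⌊δ₀ * n⌋₊ + 1 ≤ resLinWidth π' := by
      intro π' hπ'
      have h := hrank π' hπ'
      have : (⌊δ₀ * n⌋₊ : ℝ) < resLinWidth π' := (Nat.floor_le (by positivity)).trans_lt h
      have : ⌊δ₀ * n⌋₊ < resLinWidth π' := by exact_mod_cast this
      omega
    have hq := ResLinSW.pow_le_length_of_treeLike hφ3 hkw hπ htree
    have hqR : ((2 ^ (⌊δ₀ * n⌋₊ + 1 - 3 - 1) : ℕ) : ℝ) ≤ (π.length : ℝ) := by exact_mod_cast hq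
    exact hn.trans hqR
  refine tendsto_of_tendsto_of_tendsto_of_le_of_le' hlim tendsto_const_nhds hev
    (Eventually.of_forall fun n => ?_)
  exact (MeasureTheory.measure_mono (Set.subset_univ _)).trans_eq
    ((PMF.toOuterMeasure_apply_eq_one_iff _ _).2 (Set.subset_univ _))

end Corollaries

end Summit.PneNP.PneNP.Theorems
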